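import Mathlib
import Literature.MathematicalPhysics.QuantumFieldTheory.Balaban1983to89.B5Action165Lagrange
import Literature.MathematicalPhysics.QuantumFieldTheory.Balaban1983to89.B4StripCauchy

/-!
# B5 (1.66): the function under the integral, continued to complex momenta — ALGEBRA
# (an exact factorisation making its denominator zero-free near the real Brillouin zone)

Source: T. Bałaban, *Propagators and renormalization transformations for lattice gauge
theories. I*, Commun. Math. Phys. 95 (1984) 17–40 (`Balaban1984PropagatorsI`, "B5"), p. 28
(1.61)–(1.62) and p. 29 (1.65)–(1.67); the verbatim transcription of these displays is the one
certified in `B5Bounds167Lattice` (header there; renders `…rt-I/…-p012-x2.png`, `…-p013-x2.png`):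

p. 28: «φ_μ(p′) = Σ_l |u(p′+l)|² |v_μ(p′+l)|² / Δ(p′+l)» (1.62);
p. 29: «⟨B, Δ_kB⟩ = … = ½ Σ_{μ,ν} (2π)^{−d} ∫dp′ [ (Σ_{λ=1}^{d} |∂¹_λ(p′)|²/(Δ₀²(p′)φ_λ(p′)))
        Δ₀(p′)φ_μ(p′)Δ₀(p′)φ_ν(p′) ]⁻¹ |(∂₁B)~_{μν}(p′)|².   (1.66)
The function under the integral is bounded from below and above by positive constants γ₀, γ₁
dependent on d only».

B6 (*… II*, CMP 96 (1984) 223–250, `Balaban1984PropagatorsII`) p. 250 [PDF 28, render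
`…rt-II/…-p028-x2.png`, read as image this session] USES, without a numbered display, that the
unit-lattice operator `Δ_k` defined by (1.66) has an exponentially decaying kernel: «C is a
short-ranged operator, so C*Δ_kC has the same exponential decay as Δ_k. Now we may apply the theory
developed in Sect. 5 of [3] on unit lattice operators.»; in the tree this is the residual
hypothesis `B6Cov2156Torus.KernelDecay` of `B6Cov2156Torus.cov2156_torus_deltaPol`.  The route to
it is B5's own «analyticity method of proving an exponential decay» (p. 38): continue the symbol
to a complex strip `|Im p′_μ| ≤ κ` with `κ` INDEPENDENT OF `k`, and shift the contour
(`B4ContourShift`, `B4TorusKernel`).  This file supplies the ALGEBRA that makes the continuation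
of the (1.66) integrand possible; the analysis (strip bounds, holomorphy, periodic sides) and the
torus joiner are separate sibling modules.

## The obstruction, and the identity that removes it (audit mathematics; nothing here is printed)

Write `Δ(p′) = Σ_μ S_ξ(p′_μ)` (`B4Strip.DeltaXi n 0`), `Δ₀(p′) = Σ_μ S₁(p′_μ)`, `|∂¹_λ(p′)|² = S₁(p′_λ)`,
`|u(p′+l)|² = U_l(p′)` (`B4Strip.U`), `|v_λ(p′+l)|² = uFactor n l_λ p′_λ`.  Each of `Δ`, `Δ₀`, `φ_λ`
VANISHES on complex hypersurfaces through `p′ = 0` inside every strip (cf. `B4Strip.printed_factor_has_poles`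
for the same phenomenon in B4 (2.49)), so the printed bracket of (1.66) cannot be continued factor by
factor.  Put
  `c_λ := U_0 · uFactor(0, p′_λ)`,  `R̃_λ := Σ_{l≠0} U_l · uFactor(l_λ, p′_λ) / Δ(p′+l)`,
  `Y_λ := c_λ + Δ · R̃_λ`  (so `Y_λ = Δ·φ_λ` at real `p′ ≠ 0`, `Yc_ofReal`),
  `E := Σ_λ S₁(p′_λ) Π_{λ′≠λ} Y_λ′`.
Since `Σ_λ |∂¹_λ|²/(Δ₀²φ_λ) · Δ₀φ_μ · Δ₀φ_ν = φ_μφ_ν Σ_λ S₁(p′_λ)/φ_λ` (the `Δ₀²` CANCELS), the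
integrand of (1.66) is `Π_{λ∉{μ,ν}} Y_λ · Δ / E` for `μ ≠ ν`.  THE IDENTITY (`E66_eq_mul`):
  `E = Δ · F`,  `F := U_0^d + Σ_λ S₁(p′_λ) Σ_{∅≠T⊆{λ′≠λ}} Δ^{|T|−1} Π_{λ′∈T} R̃_λ′ Π_{λ′∉T, λ′≠λ} c_λ′`
(expand `Π(c + ΔR̃)`; the `T = ∅` part is `Σ_λ S₁(p′_λ) Π_{λ′≠λ} c_λ′ = U_0^d · Δ`, because
`S₁(z) = uFactor(0,z) · S_ξ(z)` — `uFactor_mul_Sxi`).  Hence (`W166`, `W166_ofReal`)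
  integrand (1.66) `= Π_{λ∉{μ,ν}} Y_λ / F`   (`μ ≠ ν`, real `p′ ≠ 0`),
a quotient of functions built from the tree's strip-holomorphic leaves by `+`, `·` and division by
the SHIFTED denominators `Δ(p′+l)`, `l ≠ 0` only (which do not vanish near the real zone,
`B4StripCauchy.re_DeltaXi_shift_ge`), whose denominator `F` satisfies on the real Brillouin zone
`F ≥ U_0^d ≥ (4/π²)^{d·d}` (`F66r_lower`; all other terms are `≥ 0`) and `F(0) = 1` (`F66r_zero`).
In `d = 2` the integrand is `1 / Σ_l |u(p′+l)|⁴` (`w166_two`).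

## What this module types and certifies [all `[folklore]` = audit mathematics about printed symbols]

§0 `uFactor_mul_Sxi` (`uFactor n j z · S_ξ(z + 2πj) = S₁(z)` on all of `ℂ`).  §1 the complex
symbols `cfac`, `Rt`, `Yc`, `E66`, `F66`, `W166`.  §2 `sum_S1_prod_cfac`, `E66_eq_mul` (E = Δ·F),
`W166_comm`.  §3 real forms `cfacr`, `Rtr`, `F66r` with `cfac_ofReal`, `Rt_ofReal`, `F66_ofReal`,
`Yc_ofReal` (`Y_λ = Δφ_λ`, φ = `B5Bounds167Lattice.phi162`; `φ_λ > 0` is `B5Action165Lagrange.phi162_pos`, by name), and THE IDENTIFICATION `W166_ofReal`: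
for `n ≥ 1`, `|s_ν| ≤ π`, `s ≠ 0`, `μ ≠ ν`, `W166 n μ ν (ofRealVec s) = B5Bounds167Lattice.w166 n μ ν s`
(the verbatim-typed (1.66) integrand).  §4 `F66r_ge_Ur_pow`, `F66r_lower`, `F66r_pos`, `F66r_zero`,
`F66_ofReal_ne_zero`.  §5 `w166_two` (d = 2).

## What is NOT claimed

Nothing printed is certified or contradicted here beyond what `B5Bounds167Lattice` already holds;
no constant is attributed to the paper; the decay of `Δ_k`'s kernel is NOT proved in this file
(no strip estimate, no contour shift, no torus sum).  At `p′ = 0` and for `μ = ν` the typed `w166`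
carries junk values and is not identified (the corresponding terms of (1.66) vanish: `(∂₁B)~_{μμ} = 0`,
`(∂₁B)~(0) = 0`).  Value = the algebraic normal form through which the (1.66) symbol admits a
`k`-uniform holomorphic continuation; ABSOLUTE RULE respected: no programme-internal statement is
cited, every `[cite]` tag points at a printed display for its TEXT only.
-/

noncomputable section

namespace Literature.MathematicalPhysics.QuantumFieldTheory.Balaban1983to89.B5Symbol166

open scoped BigOperators
open Finset Complex
open Literature.MathematicalPhysics.QuantumFieldTheory.Balaban1983to89.B4Strip
open Literature.MathematicalPhysics.QuantumFieldTheory.Balaban1983to89.B4StripCauchy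
open Literature.MathematicalPhysics.QuantumFieldTheory.Balaban1983to89.B5Prop11Leaves
open Literature.MathematicalPhysics.QuantumFieldTheory.Balaban1983to89.B5Prop11Fiber
open Literature.MathematicalPhysics.QuantumFieldTheory.Balaban1983to89.B5Bounds167Lattice

variable {d : ℕ}

/-! ## §0. One-coordinate identity: `S₁(z) = uFactor(j, z) · S_ξ(z + 2πj)` on all of `ℂ` -/

/-- a zero of `S_ξ` is a point of `2πn·ℤ`. [folklore] -/
theorem Sxi_eq_zero_imp (n : ℕ) (hn : n ≠ 0) {w : ℂ} (h : Sxi n w = 0) :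
    ∃ m : ℤ, w = (m : ℂ) * (2 * Real.pi) * n := by
  have hn' : (n : ℂ) ≠ 0 := Nat.cast_ne_zero.mpr hn
  have h2n : (2 * (n : ℂ)) ≠ 0 := mul_ne_zero two_ne_zero hn'
  rw [Sxi_eq_sin_sq n hn] at h
  have hs : Complex.sin (w / (2 * n)) = 0 := by
    have h4 : (4 : ℂ) * (n : ℂ) ^ 2 ≠ 0 := mul_ne_zero (by norm_num) (pow_ne_zero 2 hn')
    exact (pow_eq_zero_iff (n := 2) (by norm_num)).mp ((mul_eq_zero.mp h).resolve_left h4)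
  obtain ⟨m, hm⟩ := Complex.sin_eq_zero_iff.mp hs
  rw [div_eq_iff h2n] at hm
  exact ⟨m, by rw [hm]; ring⟩

/-- `uFactor n j z · S_ξ(z + 2πj) = S₁(z)` for EVERY `z ∈ ℂ` (at the zeros of the denominator both
sides vanish; at `z = 0`, `j = 0` both sides vanish). [folklore] -/
theorem uFactor_mul_Sxi (n : ℕ) (hn : n ≠ 0) (j : ℕ) (z : ℂ) :
    uFactor n j z * Sxi n (z + 2 * Real.pi * (j : ℂ)) = S1 z := by
  have key : Sxi n (z + 2 * Real.pi * (j : ℂ)) = 0 → S1 z = 0 := by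
    intro h
    obtain ⟨m, hm⟩ := Sxi_eq_zero_imp n hn h
    have hz : z = ((m * n - j : ℤ) : ℂ) * (2 * Real.pi) := by
      push_cast; linear_combination hm
    rw [hz, S1, Complex.cos_int_mul_two_pi]; norm_num
  by_cases hj : j = 0
  · subst hj
    have e0 : z + 2 * Real.pi * ((0 : ℕ) : ℂ) = z := by simp
    rw [e0] at key ⊢
    rw [uFactor_zero_eq]
    split_ifs with hz
    · subst hz; simp [Sxi, S1]
    · by_cases hS : Sxi n z = 0
      · rw [hS, key hS]; simp
      · exact div_mul_cancel₀ _ hS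
  · rw [uFactor_ne_eq n j hj]
    by_cases hS : Sxi n (z + 2 * Real.pi * (j : ℂ)) = 0
    · rw [hS, key hS]; simp
    · exact div_mul_cancel₀ _ hS

/-- the unshifted case: `uFactor n 0 z · S_ξ(z) = S₁(z)`. [folklore] -/
theorem uFactor_zero_mul_Sxi (n : ℕ) (hn : n ≠ 0) (z : ℂ) : uFactor n 0 z * Sxi n z = S1 z := by
  simpa using uFactor_mul_Sxi n hn 0 z

/-! ## §1. The complex symbols -/

section Defs

variable (n : ℕ) [NeZero n]

/-- `c_λ(p′) := U_0(p′) · uFactor(0, p′_λ)` — the `l = 0` term of `Δ(p′)φ_λ(p′)`.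
[cite: Balaban1984PropagatorsI, (1.62) p.28 (text of the formula only)] [folklore] -/
def cfac (lam : Fin d) (p : Fin d → ℂ) : ℂ :=
  U n (fun _ => (0 : Fin n)) p * uFactor n 0 (p lam)

/-- `R̃_λ(p′) := Σ_{l≠0} U_l(p′) · uFactor(l_λ, p′_λ) / Δ(p′+l)` — the `l ≠ 0` part of `φ_λ(p′)`.
[cite: Balaban1984PropagatorsI, (1.62) p.28 (text of the formula only)] [folklore] -/
def Rt (lam : Fin d) (p : Fin d → ℂ) : ℂ :=
  ∑ k ∈ univ.erase (fun _ => (0 : Fin n)),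
    U n k p * uFactor n (k lam : ℕ) (p lam) / DeltaXi n 0 (shift n k p)

/-- `Y_λ(p′) := c_λ(p′) + Δ(p′) · R̃_λ(p′)` (`= Δ(p′)φ_λ(p′)` at real `p′ ≠ 0`, `Yc_ofReal`). [folklore] -/
def Yc (lam : Fin d) (p : Fin d → ℂ) : ℂ := cfac n lam p + DeltaXi n 0 p * Rt n lam p

/-- `E(p′) := Σ_λ S₁(p′_λ) Π_{λ′≠λ} Y_λ′(p′)`. [folklore] -/
def E66 (p : Fin d → ℂ) : ℂ := ∑ lam, S1 (p lam) * ∏ lam' ∈ univ.erase lam, Yc n lam' p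

/-- `F(p′) := U_0^d + Σ_λ S₁(p′_λ) Σ_{∅≠T⊆{λ′≠λ}} Δ^{|T|−1} Π_{λ′∈T} R̃_λ′ Π_{λ′∉T,λ′≠λ} c_λ′` — the
denominator with the factor `Δ(p′)` of `E` divided out EXACTLY (`E66_eq_mul`). [folklore] -/
def F66 (p : Fin d → ℂ) : ℂ :=
  U n (fun _ => (0 : Fin n)) p ^ d
    + ∑ lam, S1 (p lam) * ∑ T ∈ ((univ.erase lam).powerset).erase ∅,
        DeltaXi n 0 p ^ (T.card - 1)
          * ((∏ lam' ∈ T, Rt n lam' p) * ∏ lam' ∈ (univ.erase lam) \ T, cfac n lam' p)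

/-- THE CONTINUED (1.66) INTEGRAND: `W_{μν}(p′) := Π_{λ∉{μ,ν}} Y_λ(p′) / F(p′)` (`μ ≠ ν`).
[cite: Balaban1984PropagatorsI, (1.66) p.29 (text of the formula only)] [folklore] -/
def W166 (μ ν : Fin d) (p : Fin d → ℂ) : ℂ :=
  (∏ lam ∈ (univ.erase μ).erase ν, Yc n lam p) / F66 n p

end Defs

/-! ## §2. The factorisation `E = Δ · F` -/

/-- `U_0(p′) = Π_λ uFactor(0, p′_λ)`. [folklore] -/
theorem U_zero_eq (n : ℕ) [NeZero n] (p : Fin d → ℂ) :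
    U n (fun _ => (0 : Fin n)) p = ∏ lam, uFactor n 0 (p lam) := by
  simp [U]

/-- the `T = ∅` part: `Σ_λ S₁(p′_λ) Π_{λ′≠λ} c_λ′(p′) = U_0(p′)^d · Δ(p′)`. [folklore] -/
theorem sum_S1_prod_cfac (n : ℕ) [NeZero n] (p : Fin d → ℂ) :
    ∑ lam, S1 (p lam) * ∏ lam' ∈ univ.erase lam, cfac n lam' p
      = U n (fun _ => (0 : Fin n)) p ^ d * DeltaXi n 0 p := by
  have hn : n ≠ 0 := NeZero.ne n
  set U0 := U n (fun _ => (0 : Fin n)) p with hU0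
  have hterm : ∀ lam : Fin d,
      S1 (p lam) * ∏ lam' ∈ univ.erase lam, cfac n lam' p = U0 ^ d * Sxi n (p lam) := by
    intro lam
    have hd : d - 1 + 1 = d := Nat.sub_add_cancel (Fin.pos lam)
    have hcard : (univ.erase lam).card = d - 1 := by
      rw [Finset.card_erase_of_mem (mem_univ lam), Finset.card_univ, Fintype.card_fin]
    have hsplit : U0 = uFactor n 0 (p lam) * ∏ lam' ∈ univ.erase lam, uFactor n 0 (p lam') := by
      rw [hU0, U_zero_eq, Finset.mul_prod_erase univ (fun lam' => uFactor n 0 (p lam')) (mem_univ lam)]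
    unfold cfac
    rw [Finset.prod_mul_distrib, Finset.prod_const, hcard, ← hU0]
    calc S1 (p lam) * (U0 ^ (d - 1) * ∏ lam' ∈ univ.erase lam, uFactor n 0 (p lam'))
        = U0 ^ (d - 1) * ((uFactor n 0 (p lam) * Sxi n (p lam))
            * ∏ lam' ∈ univ.erase lam, uFactor n 0 (p lam')) := by
          rw [uFactor_zero_mul_Sxi n hn]; ring
      _ = U0 ^ (d - 1) * U0 * Sxi n (p lam) := by rw [hsplit]; ring
      _ = U0 ^ d * Sxi n (p lam) := by rw [← pow_succ, hd]
  rw [Finset.sum_congr rfl (fun lam _ => hterm lam), ← Finset.mul_sum]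
  congr 1
  simp [DeltaXi]

/-- binomial expansion of `Π_{λ′≠λ} (c_λ′ + Δ R̃_λ′)` with the `T = ∅` term split off and one factor
`Δ` extracted from every other term. [folklore] -/
theorem prod_Yc_expand (n : ℕ) [NeZero n] (p : Fin d → ℂ) (lam : Fin d) :
    ∏ lam' ∈ univ.erase lam, Yc n lam' p
      = ∏ lam' ∈ univ.erase lam, cfac n lam' p
        + DeltaXi n 0 p * ∑ T ∈ ((univ.erase lam).powerset).erase ∅,
            DeltaXi n 0 p ^ (T.card - 1)
              * ((∏ lam' ∈ T, Rt n lam' p) * ∏ lam' ∈ (univ.erase lam) \ T, cfac n lam' p) := by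
  have h1 : ∏ lam' ∈ univ.erase lam, Yc n lam' p
      = ∏ lam' ∈ univ.erase lam, (DeltaXi n 0 p * Rt n lam' p + cfac n lam' p) :=
    Finset.prod_congr rfl (fun lam' _ => by rw [Yc, add_comm])
  rw [h1, Finset.prod_add, ← Finset.add_sum_erase _ _ (Finset.empty_mem_powerset (univ.erase lam))]
  simp only [Finset.prod_empty, Finset.sdiff_empty, one_mul]
  congr 1
  rw [Finset.mul_sum]
  refine Finset.sum_congr rfl (fun T hT => ?_)
  have hT : T ≠ ∅ := Finset.ne_of_mem_erase hT
  have hcard : T.card - 1 + 1 = T.card :=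
    Nat.sub_add_cancel (Finset.card_pos.mpr (Finset.nonempty_of_ne_empty hT))
  rw [Finset.prod_mul_distrib, Finset.prod_const]
  conv_lhs => rw [← hcard, pow_succ]
  ring

/-- **THE FACTORISATION `E = Δ · F`** (an identity of functions on all of `ℂ^d`, every `n ≥ 1`). [folklore] -/
theorem E66_eq_mul (n : ℕ) [NeZero n] (p : Fin d → ℂ) : E66 n p = DeltaXi n 0 p * F66 n p := by
  calc E66 n p
      = ∑ lam, (S1 (p lam) * ∏ lam' ∈ univ.erase lam, cfac n lam' p
          + DeltaXi n 0 p * (S1 (p lam) * ∑ T ∈ ((univ.erase lam).powerset).erase ∅,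
              DeltaXi n 0 p ^ (T.card - 1)
                * ((∏ lam' ∈ T, Rt n lam' p) * ∏ lam' ∈ (univ.erase lam) \ T, cfac n lam' p))) := by
        unfold E66
        exact Finset.sum_congr rfl (fun lam _ => by rw [prod_Yc_expand]; ring)
    _ = U n (fun _ => (0 : Fin n)) p ^ d * DeltaXi n 0 p
          + DeltaXi n 0 p * ∑ lam, S1 (p lam) * ∑ T ∈ ((univ.erase lam).powerset).erase ∅,
              DeltaXi n 0 p ^ (T.card - 1)
                * ((∏ lam' ∈ T, Rt n lam' p) * ∏ lam' ∈ (univ.erase lam) \ T, cfac n lam' p) := by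
        rw [Finset.sum_add_distrib, sum_S1_prod_cfac, Finset.mul_sum]
    _ = DeltaXi n 0 p * F66 n p := by unfold F66; ring

/-- symmetry of the continued integrand in `(μ, ν)`. [folklore] -/
theorem W166_comm (n : ℕ) [NeZero n] (μ ν : Fin d) (p : Fin d → ℂ) : W166 n μ ν p = W166 n ν μ p := by
  unfold W166; rw [Finset.erase_right_comm]

/-- where `Δ(p′) ≠ 0` the continued integrand is `Δ · Π_{λ∉{μ,ν}} Y_λ / E`. [folklore] -/
theorem W166_eq_of_ne (n : ℕ) [NeZero n] (μ ν : Fin d) (p : Fin d → ℂ) (h : DeltaXi n 0 p ≠ 0) :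
    W166 n μ ν p = DeltaXi n 0 p * (∏ lam ∈ (univ.erase μ).erase ν, Yc n lam p) / E66 n p := by
  unfold W166
  rw [E66_eq_mul, mul_div_mul_left _ _ h]

/-! ## §3. Real forms and the identification with the typed (1.66) integrand `w166` -/

section Real

variable (n : ℕ) [NeZero n]

/-- real form of `cfac`. [folklore] -/
def cfacr (lam : Fin d) (s : Fin d → ℝ) : ℝ := Ur n (fun _ => (0 : Fin n)) s * uFactorr n 0 (s lam)

/-- real form of `Rt`. [folklore] -/
def Rtr (lam : Fin d) (s : Fin d → ℝ) : ℝ :=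
  ∑ k ∈ univ.erase (fun _ => (0 : Fin n)),
    Ur n k s * uFactorr n (k lam : ℕ) (s lam) / DeltaXir n 0 (shiftr n k s)

/-- real form of `F66`. [folklore] -/
def F66r (s : Fin d → ℝ) : ℝ :=
  Ur n (fun _ => (0 : Fin n)) s ^ d
    + ∑ lam, S1r (s lam) * ∑ T ∈ ((univ.erase lam).powerset).erase ∅,
        DeltaXir n 0 s ^ (T.card - 1)
          * ((∏ lam' ∈ T, Rtr n lam' s) * ∏ lam' ∈ (univ.erase lam) \ T, cfacr n lam' s)

end Real

/-- `cfac` is real on real momenta. [folklore] -/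
theorem cfac_ofReal (n : ℕ) [NeZero n] (lam : Fin d) (s : Fin d → ℝ) :
    cfac n lam (ofRealVec s) = ((cfacr n lam s : ℝ) : ℂ) := by
  unfold cfac cfacr
  rw [U_ofReal, show ofRealVec s lam = ((s lam : ℝ) : ℂ) from rfl, uFactor_ofReal]
  push_cast; ring

/-- `Rt` is real on real momenta. [folklore] -/
theorem Rt_ofReal (n : ℕ) [NeZero n] (lam : Fin d) (s : Fin d → ℝ) :
    Rt n lam (ofRealVec s) = ((Rtr n lam s : ℝ) : ℂ) := by
  unfold Rt Rtr
  push_cast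
  refine Finset.sum_congr rfl (fun k _ => ?_)
  rw [U_ofReal, shift_ofReal, DeltaXi_ofReal, show ofRealVec s lam = ((s lam : ℝ) : ℂ) from rfl,
    uFactor_ofReal]

/-- `S₁` at a real coordinate. [folklore] -/
theorem S1_ofRealVec (s : Fin d → ℝ) (lam : Fin d) : S1 (ofRealVec s lam) = ((S1r (s lam) : ℝ) : ℂ) := by
  rw [show ofRealVec s lam = ((s lam : ℝ) : ℂ) from rfl, S1_ofReal]

/-- `F66` is real on real momenta. [folklore] -/
theorem F66_ofReal (n : ℕ) [NeZero n] (s : Fin d → ℝ) :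
    F66 n (ofRealVec s) = ((F66r n s : ℝ) : ℂ) := by
  unfold F66 F66r
  rw [U_ofReal, DeltaXi_ofReal]
  push_cast
  congr 1
  refine Finset.sum_congr rfl (fun lam _ => ?_)
  rw [S1_ofRealVec]
  congr 1
  refine Finset.sum_congr rfl (fun T _ => ?_)
  rw [Finset.prod_congr rfl (fun lam' _ => Rt_ofReal n lam' s),
    Finset.prod_congr rfl (fun lam' _ => cfac_ofReal n lam' s)]

/-- the real identity behind `Yc_ofReal`: on the punctured Brillouin zone
`c_λ(s) + Δ(s)·R̃_λ(s) = Δ(s)·φ_λ(s)` with `φ_λ = phi162` of (1.62). [folklore] -/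
theorem cfacr_add_eq (n : ℕ) [NeZero n] (hn : 1 ≤ n) (lam : Fin d) (s : Fin d → ℝ)
    (hs : ∀ ν, |s ν| ≤ Real.pi) (ν₀ : Fin d) (hν₀ : s ν₀ ≠ 0) :
    cfacr n lam s + DeltaXir n 0 s * Rtr n lam s = DeltaXir n 0 s * phi162 n lam s := by
  have hΔ : DeltaXir n 0 s ≠ 0 := (DeltaXir_pos n hn s hs ν₀ hν₀).ne'
  rw [phi162_eq n hn lam s hs,
    ← Finset.add_sum_erase _ _ (Finset.mem_univ (fun _ => (0 : Fin n))), mul_add, Finset.mul_sum]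
  unfold cfacr Rtr
  rw [Finset.mul_sum]
  congr 1
  · simp only [shiftr_zero, Fin.val_zero]
    field_simp

/-- **`Y_λ = Δ·φ_λ` ON THE REALS**: for `n ≥ 1`, `|s_ν| ≤ π`, `s ≠ 0`:
`Yc n λ (ofRealVec s) = Δ(s) · φ_λ(s)` (`φ_λ = B5Bounds167Lattice.phi162`, (1.62) verbatim). [folklore] -/
theorem Yc_ofReal (n : ℕ) [NeZero n] (hn : 1 ≤ n) (lam : Fin d) (s : Fin d → ℝ)
    (hs : ∀ ν, |s ν| ≤ Real.pi) (ν₀ : Fin d) (hν₀ : s ν₀ ≠ 0) :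
    Yc n lam (ofRealVec s) = ((DeltaXir n 0 s * phi162 n lam s : ℝ) : ℂ) := by
  unfold Yc
  rw [cfac_ofReal, DeltaXi_ofReal, Rt_ofReal, ← cfacr_add_eq n hn lam s hs ν₀ hν₀]
  push_cast; ring

/-- `S₁ > 0` at a nonzero point of `[−π, π]`. [folklore] -/
theorem S1r_pos_of_ne {x : ℝ} (hx : |x| ≤ Real.pi) (hx0 : x ≠ 0) : 0 < S1r x := by
  have h4 := S1r_ge x hx
  have h0 : 0 < x ^ 2 := lt_of_le_of_ne (sq_nonneg _) (Ne.symm (pow_ne_zero 2 hx0))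
  have h5 : 0 < 4 * x ^ 2 / Real.pi ^ 2 := by positivity
  linarith

/-- the real algebra of the identification (pure bookkeeping): for positive `φ_κ`, `Δ`, `Δ₀`, nonnegative
`S_κ` not all zero and `μ ≠ ν`,
`1 / ((Σ_κ S_κ/(Δ₀²φ_κ))·Δ₀φ_μ·Δ₀φ_ν) = Π_{λ∉{μ,ν}} (Δφ_λ) · Δ / Σ_κ S_κ Π_{λ′≠κ} (Δφ_λ′)`. [folklore] -/
theorem algebra166_core {φ S : Fin d → ℝ} {Δ Δ0 : ℝ} (hφ : ∀ κ, 0 < φ κ) (hΔ : 0 < Δ) (hΔ0 : 0 < Δ0)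
    (hS : ∀ κ, 0 ≤ S κ) (ν₀ : Fin d) (hS0 : 0 < S ν₀) {μ ν : Fin d} (hμν : μ ≠ ν) :
    1 / ((∑ κ, S κ / (Δ0 ^ 2 * φ κ)) * (Δ0 * φ μ) * (Δ0 * φ ν))
      = (∏ lam ∈ (univ.erase μ).erase ν, Δ * φ lam) * Δ
          / ∑ κ, S κ * ∏ lam' ∈ univ.erase κ, Δ * φ lam' := by
  have hy : ∀ κ, 0 < Δ * φ κ := fun κ => mul_pos hΔ (hφ κ)
  have hν : ν ∈ univ.erase μ := Finset.mem_erase.mpr ⟨hμν.symm, Finset.mem_univ ν⟩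
  -- `P = (Δφ_μ)(Δφ_ν)·Q`
  have hPQ : ∏ lam, Δ * φ lam
      = (Δ * φ μ) * ((Δ * φ ν) * ∏ lam ∈ (univ.erase μ).erase ν, Δ * φ lam) := by
    rw [Finset.mul_prod_erase _ (fun lam => Δ * φ lam) hν,
      Finset.mul_prod_erase _ (fun lam => Δ * φ lam) (Finset.mem_univ μ)]
  have hQ0 : (∏ lam ∈ (univ.erase μ).erase ν, Δ * φ lam) ≠ 0 :=
    (Finset.prod_pos fun lam _ => hy lam).ne'
  -- `Σ_κ S_κ Π_{λ′≠κ} (Δφ_λ′) = P · Σ_κ S_κ/(Δφ_κ)`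
  have hE : ∑ κ, S κ * ∏ lam' ∈ univ.erase κ, Δ * φ lam'
      = (∏ lam, Δ * φ lam) * ∑ κ, S κ / (Δ * φ κ) := by
    rw [Finset.mul_sum]
    refine Finset.sum_congr rfl (fun κ _ => ?_)
    have hk : ∏ lam' ∈ univ.erase κ, Δ * φ lam' = (∏ lam, Δ * φ lam) / (Δ * φ κ) := by
      rw [eq_div_iff (hy κ).ne']
      exact Finset.prod_erase_mul _ (fun lam => Δ * φ lam) (Finset.mem_univ κ)
    rw [hk]
    have := (hy κ).ne'
    field_simp
  -- `Σ_κ S_κ/(Δ₀²φ_κ) = (Δ/Δ₀²) Σ_κ S_κ/(Δφ_κ)`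
  have hC : ∑ κ, S κ / (Δ0 ^ 2 * φ κ) = Δ / Δ0 ^ 2 * ∑ κ, S κ / (Δ * φ κ) := by
    rw [Finset.mul_sum]
    refine Finset.sum_congr rfl (fun κ _ => ?_)
    have := (hφ κ).ne'
    field_simp
  have hσ : 0 < ∑ κ, S κ / (Δ * φ κ) := by
    have hle : S ν₀ / (Δ * φ ν₀) ≤ ∑ κ, S κ / (Δ * φ κ) :=
      Finset.single_le_sum (f := fun κ => S κ / (Δ * φ κ))
        (fun κ _ => div_nonneg (hS κ) (hy κ).le) (Finset.mem_univ ν₀)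
    exact lt_of_lt_of_le (div_pos hS0 (hy ν₀)) hle
  rw [hC, hE, hPQ]
  have h1 := (hφ μ).ne'
  have h2 := (hφ ν).ne'
  have h3 := hσ.ne'
  have h4 := hΔ.ne'
  have h5 := hΔ0.ne'
  field_simp

/-- the typed (1.66) integrand in normal form: with `y_λ := Δφ_λ`,
`w166 = Π_{λ∉{μ,ν}} y_λ · Δ / (Σ_κ S₁(s_κ) Π_{λ′≠κ} y_λ′)` on the punctured zone, `μ ≠ ν`. [folklore] -/
theorem w166_eq_prod_div (n : ℕ) [NeZero n] (hn : 1 ≤ n) {μ ν : Fin d} (hμν : μ ≠ ν) (s : Fin d → ℝ)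
    (hs : ∀ κ, |s κ| ≤ Real.pi) (ν₀ : Fin d) (hν₀ : s ν₀ ≠ 0) :
    w166 n μ ν s
      = (∏ lam ∈ (univ.erase μ).erase ν, DeltaXir n 0 s * phi162 n lam s) * DeltaXir n 0 s
          / ∑ κ, S1r (s κ) * ∏ lam' ∈ univ.erase κ, DeltaXir n 0 s * phi162 n lam' s := by
  unfold w166
  simp only [norm_d1Sym_sq]
  exact algebra166_core (fun κ => B5Action165Lagrange.phi162_pos n hn κ s hs ν₀ hν₀) (DeltaXir_pos n hn s hs ν₀ hν₀)
    (Delta1r_pos s hs ν₀ hν₀) (fun κ => S1r_nonneg (s κ)) ν₀ (S1r_pos_of_ne (hs ν₀) hν₀) hμν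

/-- **THE IDENTIFICATION**: for `n = L^k ≥ 1`, `|s_ν| ≤ π`, `s ≠ 0` and `μ ≠ ν`, the continued
integrand at the real momentum `s` IS the verbatim-typed function under the integral of (1.66):
`W166 n μ ν (ofRealVec s) = B5Bounds167Lattice.w166 n μ ν s`. [cite: Balaban1984PropagatorsI, (1.66) p.29
(text of the formula only)] [folklore] -/
theorem W166_ofReal (n : ℕ) [NeZero n] (hn : 1 ≤ n) {μ ν : Fin d} (hμν : μ ≠ ν) (s : Fin d → ℝ)
    (hs : ∀ κ, |s κ| ≤ Real.pi) (ν₀ : Fin d) (hν₀ : s ν₀ ≠ 0) :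
    W166 n μ ν (ofRealVec s) = ((w166 n μ ν s : ℝ) : ℂ) := by
  have hΔp : 0 < DeltaXir n 0 s := DeltaXir_pos n hn s hs ν₀ hν₀
  have hΔ : DeltaXi n 0 (ofRealVec s) ≠ 0 := by
    rw [DeltaXi_ofReal]; exact_mod_cast hΔp.ne'
  have hY : ∀ lam, Yc n lam (ofRealVec s) = ((DeltaXir n 0 s * phi162 n lam s : ℝ) : ℂ) :=
    fun lam => Yc_ofReal n hn lam s hs ν₀ hν₀
  have hE : E66 n (ofRealVec s)
      = ((∑ κ, S1r (s κ) * ∏ lam' ∈ univ.erase κ, DeltaXir n 0 s * phi162 n lam' s : ℝ) : ℂ) := by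
    unfold E66
    push_cast
    refine Finset.sum_congr rfl (fun κ _ => ?_)
    rw [S1_ofRealVec, Finset.prod_congr rfl (fun lam' _ => hY lam')]
    push_cast
    rfl
  rw [W166_eq_of_ne n μ ν _ hΔ, hE, Finset.prod_congr rfl (fun lam _ => hY lam), DeltaXi_ofReal,
    w166_eq_prod_div n hn hμν s hs ν₀ hν₀]
  push_cast; ring

/-! ## §4. The denominator `F` on the real Brillouin zone: `F ≥ U_0^d ≥ (4/π²)^{d·d}`, `F(0) = 1` -/

/-- `c_λ ≥ 0` on the reals. [folklore] -/
theorem cfacr_nonneg (n : ℕ) [NeZero n] (lam : Fin d) (s : Fin d → ℝ) : 0 ≤ cfacr n lam s :=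
  mul_nonneg (Ur_nonneg _ _ _) (uFactorr_nonneg _ _ _)

/-- `R̃_λ ≥ 0` on the reals. [folklore] -/
theorem Rtr_nonneg (n : ℕ) [NeZero n] (lam : Fin d) (s : Fin d → ℝ) : 0 ≤ Rtr n lam s :=
  Finset.sum_nonneg fun _ _ =>
    div_nonneg (mul_nonneg (Ur_nonneg _ _ _) (uFactorr_nonneg _ _ _)) (DeltaXir_nonneg _ 0 le_rfl _)

/-- `F(s) ≥ U_0(s)^d` on the reals (every other term is `≥ 0`). [folklore] -/
theorem F66r_ge_Ur_pow (n : ℕ) [NeZero n] (s : Fin d → ℝ) :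
    Ur n (fun _ => (0 : Fin n)) s ^ d ≤ F66r n s := by
  unfold F66r
  have : 0 ≤ ∑ lam, S1r (s lam) * ∑ T ∈ ((univ.erase lam).powerset).erase ∅,
      DeltaXir n 0 s ^ (T.card - 1)
        * ((∏ lam' ∈ T, Rtr n lam' s) * ∏ lam' ∈ (univ.erase lam) \ T, cfacr n lam' s) := by
    refine Finset.sum_nonneg fun lam _ => mul_nonneg (S1r_nonneg _) ?_
    refine Finset.sum_nonneg fun T _ => mul_nonneg (pow_nonneg (DeltaXir_nonneg _ 0 le_rfl _) _) ?_
    exact mul_nonneg (Finset.prod_nonneg fun _ _ => Rtr_nonneg _ _ _)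
      (Finset.prod_nonneg fun _ _ => cfacr_nonneg _ _ _)
  linarith

/-- **`F ≥ (4/π²)^{d·d}` ON THE WHOLE REAL BRILLOUIN ZONE** (including `s = 0`), for every `n = L^k ≥ 1`
(Jordan: `U_0 ≥ (4/π²)^d`, `B4Strip.Ur_zero_ge`). [folklore] -/
theorem F66r_lower (n : ℕ) [NeZero n] (hn : 1 ≤ n) (s : Fin d → ℝ) (hs : ∀ ν, |s ν| ≤ Real.pi) :
    ((4 / Real.pi ^ 2) ^ d) ^ d ≤ F66r n s := by
  have h1 := Ur_zero_ge n hn s hs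
  have h0 : 0 ≤ (4 / Real.pi ^ 2 : ℝ) ^ d := by positivity
  exact (pow_le_pow_left₀ h0 h1 d).trans (F66r_ge_Ur_pow n s)

/-- `F > 0` on the real Brillouin zone. [folklore] -/
theorem F66r_pos (n : ℕ) [NeZero n] (hn : 1 ≤ n) (s : Fin d → ℝ) (hs : ∀ ν, |s ν| ≤ Real.pi) :
    0 < F66r n s :=
  lt_of_lt_of_le (by positivity) (F66r_lower n hn s hs)

/-- the continued denominator does not vanish at real momenta of the zone. [folklore] -/
theorem F66_ofReal_ne_zero (n : ℕ) [NeZero n] (hn : 1 ≤ n) (s : Fin d → ℝ) (hs : ∀ ν, |s ν| ≤ Real.pi) :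
    F66 n (ofRealVec s) ≠ 0 := by
  rw [F66_ofReal]; exact_mod_cast (F66r_pos n hn s hs).ne'

/-- `U_0(0) = 1`. [folklore] -/
theorem Ur_zero_at_zero (n : ℕ) [NeZero n] : Ur n (fun _ => (0 : Fin n)) (fun _ : Fin d => (0 : ℝ)) = 1 := by
  simp [Ur, uFactorr]

/-- `F(0) = 1` (the value the paper assigns to the integrand at `p′ = 0` «as a limit» is finite and
nonzero in the normal form). [folklore] -/
theorem F66r_zero (n : ℕ) [NeZero n] : F66r n (fun _ : Fin d => (0 : ℝ)) = 1 := by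
  unfold F66r
  rw [Ur_zero_at_zero]
  simp [S1r]

/-! ## §5. `d = 2`: the integrand of (1.66) is `1 / Σ_l |u(p′+l)|⁴` -/

/-- `S₁(x) = uFactorr(j, x) · S_ξ(x + 2πj)` on the reals (`j < n`, `|x| ≤ π`, `x ≠ 0` if `j = 0` not needed:
real form of `uFactor_mul_Sxi`). [folklore] -/
theorem uFactorr_mul_Sxir (n : ℕ) (hn : n ≠ 0) (j : ℕ) (x : ℝ) :
    uFactorr n j x * Sxir n (x + 2 * Real.pi * (j : ℝ)) = S1r x := by
  have h := uFactor_mul_Sxi n hn j (x : ℂ)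
  have e : (x : ℂ) + 2 * Real.pi * (j : ℂ) = ((x + 2 * Real.pi * (j : ℝ) : ℝ) : ℂ) := by push_cast; ring
  rw [e, uFactor_ofReal, Sxi_ofReal, S1_ofReal] at h
  exact_mod_cast h

/-- in `d = 2`, for `μ ≠ ν`: `S₁(s_μ)·uFactorr(k_ν, s_ν) + S₁(s_ν)·uFactorr(k_μ, s_μ) = U_k(s) · Δ(s + 2πk)`. [folklore] -/
theorem two_dim_numerator (n : ℕ) [NeZero n] {μ ν : Fin 2} (hμν : μ ≠ ν) (k : Fin 2 → Fin n) (s : Fin 2 → ℝ) :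
    S1r (s μ) * uFactorr n (k ν : ℕ) (s ν) + S1r (s ν) * uFactorr n (k μ : ℕ) (s μ)
      = Ur n k s * DeltaXir n 0 (shiftr n k s) := by
  have hn : n ≠ 0 := NeZero.ne n
  have huniv : (Finset.univ : Finset (Fin 2)) = {μ, ν} := by
    symm; apply Finset.eq_univ_of_card; rw [Finset.card_pair hμν]; simp
  have hU : Ur n k s = uFactorr n (k μ : ℕ) (s μ) * uFactorr n (k ν : ℕ) (s ν) := by
    unfold Ur; rw [huniv, Finset.prod_pair hμν]
  have hD : DeltaXir n 0 (shiftr n k s)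
      = Sxir n (s μ + 2 * Real.pi * ((k μ : ℕ) : ℝ)) + Sxir n (s ν + 2 * Real.pi * ((k ν : ℕ) : ℝ)) := by
    unfold DeltaXir shiftr; rw [huniv, Finset.sum_pair hμν]; simp
  rw [hU, hD, ← uFactorr_mul_Sxir n hn (k μ : ℕ) (s μ), ← uFactorr_mul_Sxir n hn (k ν : ℕ) (s ν)]
  ring

/-- **`d = 2`**: on the punctured Brillouin zone, for `μ ≠ ν` and every `n = L^k ≥ 1`, the function under
the integral of (1.66) is `1 / Σ_l |u(p′+l)|⁴` (`|u(p′+l)|² = Ur`). [folklore] -/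
theorem w166_two (n : ℕ) [NeZero n] (hn : 1 ≤ n) {μ ν : Fin 2} (hμν : μ ≠ ν) (s : Fin 2 → ℝ)
    (hs : ∀ κ, |s κ| ≤ Real.pi) (ν₀ : Fin 2) (hν₀ : s ν₀ ≠ 0) :
    w166 n μ ν s = 1 / ∑ k : Fin 2 → Fin n, Ur n k s ^ 2 := by
  have hΔ0 : 0 < Delta1r 0 s := Delta1r_pos s hs ν₀ hν₀
  have hφ : ∀ κ, 0 < phi162 n κ s := fun κ => B5Action165Lagrange.phi162_pos n hn κ s hs ν₀ hν₀
  have huniv : (Finset.univ : Finset (Fin 2)) = {μ, ν} := by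
    symm; apply Finset.eq_univ_of_card; rw [Finset.card_pair hμν]; simp
  -- the bracket in d = 2
  have hbr : (∑ κ : Fin 2, ‖d1Sym s κ‖ ^ 2 / (Delta1r 0 s ^ 2 * phi162 n κ s))
        * (Delta1r 0 s * phi162 n μ s) * (Delta1r 0 s * phi162 n ν s)
      = S1r (s μ) * phi162 n ν s + S1r (s ν) * phi162 n μ s := by
    rw [huniv, Finset.sum_pair hμν, norm_d1Sym_sq, norm_d1Sym_sq]
    have h1 := (hφ μ).ne'
    have h2 := (hφ ν).ne'
    have h3 := hΔ0.ne'
    field_simp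
  -- `S₁(s_μ)φ_ν + S₁(s_ν)φ_μ = Σ_k U_k²`
  have hsum : S1r (s μ) * phi162 n ν s + S1r (s ν) * phi162 n μ s = ∑ k : Fin 2 → Fin n, Ur n k s ^ 2 := by
    rw [phi162_eq n hn ν s hs, phi162_eq n hn μ s hs, Finset.mul_sum, Finset.mul_sum, ← Finset.sum_add_distrib]
    refine Finset.sum_congr rfl (fun k _ => ?_)
    have hDk : 0 < DeltaXir n 0 (shiftr n k s) := by
      by_cases hk : k = fun _ => 0
      · subst hk; rw [shiftr_zero]; exact DeltaXir_pos n hn s hs ν₀ hν₀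
      · linarith [DeltaXir_shift_ge_four n k hk s hs]
    rw [show S1r (s μ) * (Ur n k s * uFactorr n (k ν : ℕ) (s ν) / DeltaXir n 0 (shiftr n k s))
        + S1r (s ν) * (Ur n k s * uFactorr n (k μ : ℕ) (s μ) / DeltaXir n 0 (shiftr n k s))
        = Ur n k s * (S1r (s μ) * uFactorr n (k ν : ℕ) (s ν) + S1r (s ν) * uFactorr n (k μ : ℕ) (s μ))
            / DeltaXir n 0 (shiftr n k s) by ring,
      two_dim_numerator n hμν k s]
    have := hDk.ne'
    field_simp
  unfold w166
  rw [hbr, hsum]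

end Literature.MathematicalPhysics.QuantumFieldTheory.Balaban1983to89.B5Symbol166

end
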